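import Summits.Ventures.PercRepro.S1ChainCoNullCellsT
import Summits.Ventures.PercRepro.S1KillCellTenFive
import Summits.Ventures.PercRepro.S1SeriesLever

/-!
# PercRepro — THE CELL `(10, 7)` MODULO ONE JOINT CAP (p2, gen 24; SUBCLAIM-S1 §6.9 (viii))

The last cell of row 10 reduced to ONE statement: `c025_core_ten_seven_of_joint_cap` proves `RLS` at `(10, 4)` for
every `e`-free core of rank `10` on `17` points from the hypothesis «a coloop-free `e`-free core of rank `10` on `17`
points with at least `9` triangles has at most `32` four-circuits». Everything else is in the tree: the coloop-free
case runs the per-pair chain lines with the co-nullity credit on the caps `(t, S t, 331)`, `S t = 47` (the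
series-class cap) for `t ≤ 8` and `32` (the hypothesis) for `t = 9, 10, 11`, with `r = 1, 1, 1, 1, 4, 5, 5, 6, 6, 6, 6`;
one coloop (`9` on `16`, caps `11 / 49 / 340`) and two coloops (`8` on `15`, `11 / 57 / 351`) close on the proved caps
alone; `c ≥ 3` lossy. Exact-integer twin mining/p2/g24/lines107.py (the hypothesis is needed at `t = 9, 10, 11`
only; `32` is the largest value that closes — `33` fails at `t = 11, u = 16` by `243`). The five-skew-triangle
configurations satisfy the hypothesis with `s₄ ≤ 3 + 3 + 22 = 28` (S1ChainSkewCapSharp, S1ChainPairCount); the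
four-skew configurations are the open part (§6.9 (vii)).

* `capTenSeven` — the per-`t` cap; `gb_cap_seven` — the series-class cap instantiated; `rrTenSeven0/1/2`;
* **`c025_core_ten_seven_of_joint_cap`** — the conditional cell.
Axioms: standard.
-/

open scoped Matroid

namespace PercRepro

namespace S1

open Set

variable {α : Type}

/-- The four-circuit cap of the conditional cell at triangle count `t`: `47` for `t ≤ 8`, `32` beyond. -/
def capTenSeven (t : ℕ) : ℕ := if t ≤ 8 then 47 else 32

/-- **The series-class cap at `(10, 17)`, `(9, 16)`, `(8, 15)`** (nullity `7`): `s₄ ≤ gb 7 n` on the coloop-free part. -/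
theorem gb_cap_seven (p n S : ℕ) (hn : n = p + 7) (hv : gb 7 n = S) : ∀ (N : Matroid α) [N.Finite],
    (∀ e ∈ N.E, ∃ A ⊆ N.E \ {e}, e ∉ N.closure A ∧ e ∉ N.closure ((N.E \ {e}) \ A)) →
    N.E.encard = N.eRank + ((7 : ℕ) : ℕ∞) → N.E.ncard = p + 7 → N.coloops = ∅ →
    {C : Set α | N.IsCircuit C ∧ C.ncard = 4}.ncard ≤ S := by
  intro N _ hfree hd hn' hcol
  have h := ncard_fourCircuits_le_gb_of_coloopFree N hfree hd hcol hn'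
  rwa [← hn, hv] at h

/-- The chain length `r` at each `t = s₃` (coloop-free case). -/
def rrTenSeven0 (t : ℕ) : ℕ := [0, 1, 1, 1, 1, 4, 5, 5, 6, 6, 6, 6].getD t 0

/-- The chain length `r` at each `t` (one coloop). -/
def rrTenSeven1 (t : ℕ) : ℕ := [0, 1, 1, 1, 1, 1, 5, 5, 6, 6, 6, 6].getD t 0

/-- The chain length `r` at each `t` (two coloops). -/
def rrTenSeven2 (t : ℕ) : ℕ := [0, 1, 1, 1, 1, 1, 1, 1, 1, 1, 1, 1].getD t 0

/-- **THE CELL `(10, 7)` MODULO THE JOINT CAP**: an `e`-free core of rank `10` with `17` points satisfies `RLS` at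
level `4`, provided every coloop-free `e`-free core of rank `10` on `17` points with `≥ 9` triangles has `≤ 32`
four-circuits. -/
theorem c025_core_ten_seven_of_joint_cap (M : Matroid α) [M.Finite] (hR : M.eRank = (10 : ℕ)) (hn : M.E.ncard = 17)
    (hfree : ∀ e ∈ M.E, ∃ A ⊆ M.E \ {e}, e ∉ M.closure A ∧ e ∉ M.closure ((M.E \ {e}) \ A))
    (hjoint : ∀ (N : Matroid α) [N.Finite],
      (∀ e ∈ N.E, ∃ A ⊆ N.E \ {e}, e ∉ N.closure A ∧ e ∉ N.closure ((N.E \ {e}) \ A)) →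
      N.E.encard = N.eRank + ((7 : ℕ) : ℕ∞) → N.E.ncard = 17 → N.coloops = ∅ →
      9 ≤ {C : Set α | N.IsCircuit C ∧ C.ncard = 3}.ncard →
      {C : Set α | N.IsCircuit C ∧ C.ncard = 4}.ncard ≤ 32) :
    ThmN.RLS M 10 4 := by
  rcases (show M.coloops.ncard = 0 ∨ M.coloops.ncard = 1 ∨ M.coloops.ncard = 2 ∨ 3 ≤ M.coloops.ncard by omega)
    with h | h | h | h
  · refine rls_of_ladder_case_chain_conull_capT M (p := 10) (c := 0) (d := 7) (by norm_num) (by norm_num) hR hn hfree h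
      (by norm_num) (by norm_num) (P := 11) (S5 := 331) capTenSeven (by decide) ?_
      (by decide) rrTenSeven0 (by decide) (by decide +kernel) (by decide +kernel) (by decide +kernel)
    intro N _ hNfree hNd hNn hNcol t ht
    unfold capTenSeven
    split_ifs with h8
    · exact gb_cap_seven 10 17 47 rfl (by decide) N hNfree hNd hNn hNcol
    · exact hjoint N hNfree hNd hNn hNcol (by omega)
  · exact rls_of_ladder_case_chain_conull M (p := 9) (c := 1) (d := 7) (by norm_num) (by norm_num) hR hn hfree h
      (by norm_num) (by norm_num) (P := 11) (S := 49) (S5 := 340) (by decide) (gb_cap_seven 9 16 49 rfl (by decide))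
      (by decide) rrTenSeven1 (by decide) (by decide +kernel) (by decide +kernel) (by decide +kernel)
  · exact rls_of_ladder_case_chain_conull M (p := 8) (c := 2) (d := 7) (by norm_num) (by norm_num) hR hn hfree h
      (by norm_num) (by norm_num) (P := 11) (S := 57) (S5 := 351) (by decide) (gb_cap_seven 8 15 57 rfl (by decide))
      (by decide) rrTenSeven2 (by decide) (by decide +kernel) (by decide +kernel) (by decide +kernel)
  · exact rls_of_coloops_lossy M (p := 7) (c := 3) (hR.trans (by norm_num)) (by norm_num) h phiK_ten_four_le

end S1

end PercRepro
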